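import Summits.CriticalPhenomena.PercolationContinuityZ3.Theorems.PercNearOneGluingAdditiveGluingEdgeAffine
import Summits.CriticalPhenomena.PercolationContinuityZ3.Theorems.PercNearOneGluingAdditiveGluingTieLiftOne
import Literature.Probability.Percolation.KozmaNitzanSeparatingTriple
import Literature.Probability.LatticeModels.ProdBernoulliIndependence
import HarnessLib

/-!
# `NoHeavyLowerTail` (stmt-CriticalPhenomena-4575) — two-port observers: combinatorics of the virtual pairs at `o`,
# the two-pair decomposition of `μ_w`, and the real-number core of the two-port exchange (tools)

Support file (lemma factory #8 `prim-lf-8`, gen 9; `--supports stmt-CriticalPhenomena-4575`).  No definitions, no named facts,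
no sorries.  `μ = prodBernoulli w` on `Fin n`, relays `A`, level `j`, `π(v) = {r ∈ A : v ↔ r}`.
Tools for `…TwoPortExchange.lean` (REX(2) for an observer `o ∉ A` adjacent to at most the two relays `a, b`):
* reachability after opening one / two virtual pairs `s(o,a)`, `s(o,b)` at an ISOLATED vertex `o` (`KNSep.reachable_insert_iff`):
  `reachable_insert_one_iff`, `reachable_insert_one_o_iff`, `reachable_insert_two_iff`, `reachable_insert_two_o_iff`, and the
  induced relay counts `filter_insert_one_o`, `filter_insert_one_ne`, `filter_insert_two_o`, `filter_insert_two_of_reach`,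
  `filter_insert_two_of_not_reach`;
* `real_eq_real_inter_isolated` — under weights vanishing at `o`, almost surely no pair at `o` is open;
* `real_twoPair_decomp` — `μ_w(S) = (1−α)(1−β)μ₀(S) + (1−α)βμ₀(S+ob) + α(1−β)μ₀(S+oa) + αβμ₀(S+oa+ob)`
  (`stub_oneBondDecomp_k15` + `tieLiftOne_real_one_eq` twice; `μ₀` = both pairs switched off);
* `twoPort_algebra` — from `(1−t)p + tg ≤ (1−t)P + tG`, `(1−t)r + tg ≤ (1−t)R + tG`, `gP ≤ Gp`, `t = αβ`:
  `α(1−β)p + (1−α)βr + tg ≤ α(1−β)P + (1−α)βR + tG`.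
-/

noncomputable section

namespace Summit.CriticalPhenomena.PercolationContinuityZ3.Theorems

open MeasureTheory Set Literature.Probability.LatticeModels Literature.Probability.Percolation
open scoped Classical BigOperators

variable {n : ℕ}

namespace TwoPortExchange

/-! ### Combinatorics: an isolated vertex and one or two virtual pairs at it -/

/-- If no pair at `o` is open then `o` reaches only itself. [folklore] -/
theorem reachable_isolated_iff {ω : BondConfig (Fin n)} {o : Fin n} (hN : ∀ v, v ≠ o → s(o, v) ∉ ω) (z : Fin n) :
    (openGraph ω).Reachable o z ↔ z = o := by
  constructor
  · rintro ⟨p⟩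
    cases p with
    | nil => rfl
    | cons hadj p =>
      rename_i v
      clear p
      rcases (openGraph_adj ω o v).1 hadj with ⟨hmem, hne⟩
      exact absurd hmem (hN v (Ne.symm hne))
  · rintro rfl
    exact SimpleGraph.Reachable.refl _

/-- One virtual pair `s(o,a)` at an isolated `o`: vertices other than `o` are joined as before. [folklore] -/
theorem reachable_insert_one_iff {ω : BondConfig (Fin n)} {o a : Fin n} (hN : ∀ v, v ≠ o → s(o, v) ∉ ω)
    {x y : Fin n} (hx : x ≠ o) (hy : y ≠ o) :
    (openGraph (insert s(o, a) ω)).Reachable x y ↔ (openGraph ω).Reachable x y := by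
  rw [KNSep.reachable_insert_iff]
  have h1 : ¬ (openGraph ω).Reachable x o := fun h => hx (((reachable_isolated_iff hN x).1 h.symm))
  have h2 : ¬ (openGraph ω).Reachable o y := fun h => hy ((reachable_isolated_iff hN y).1 h)
  tauto

/-- One virtual pair `s(o,a)` at an isolated `o`: `o` is joined exactly to the cluster of `a`. [folklore] -/
theorem reachable_insert_one_o_iff {ω : BondConfig (Fin n)} {o a : Fin n} (hN : ∀ v, v ≠ o → s(o, v) ∉ ω)
    (hao : a ≠ o) {y : Fin n} (hy : y ≠ o) :
    (openGraph (insert s(o, a) ω)).Reachable o y ↔ (openGraph ω).Reachable a y := by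
  rw [KNSep.reachable_insert_iff]
  have h2 : ¬ (openGraph ω).Reachable o y := fun h => hy ((reachable_isolated_iff hN y).1 h)
  have h3 : ¬ (openGraph ω).Reachable o a := fun h => hao ((reachable_isolated_iff hN a).1 h)
  have h4 : (openGraph ω).Reachable o o := SimpleGraph.Reachable.refl o
  tauto

/-- Two virtual pairs `s(o,a)`, `s(o,b)` at an isolated `o`: vertices other than `o` are joined iff they were, or one reaches `a`
and the other `b` (through the bridge `a – o – b`). [folklore] -/
theorem reachable_insert_two_iff {ω : BondConfig (Fin n)} {o a b : Fin n} (hN : ∀ v, v ≠ o → s(o, v) ∉ ω)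
    (hao : a ≠ o) (hbo : b ≠ o) {x y : Fin n} (hx : x ≠ o) (hy : y ≠ o) :
    (openGraph (insert s(o, a) (insert s(o, b) ω))).Reachable x y ↔
      (openGraph ω).Reachable x y ∨ ((openGraph ω).Reachable x b ∧ (openGraph ω).Reachable a y) ∨
        ((openGraph ω).Reachable x a ∧ (openGraph ω).Reachable b y) := by
  rw [KNSep.reachable_insert_iff, reachable_insert_one_iff hN hx hy, reachable_insert_one_iff hN hao hy,
    reachable_insert_one_iff hN hx hao]
  have e1 : (openGraph (insert s(o, b) ω)).Reachable x o ↔ (openGraph ω).Reachable x b := by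
    rw [SimpleGraph.reachable_comm, reachable_insert_one_o_iff hN hbo hx, SimpleGraph.reachable_comm]
  have e2 : (openGraph (insert s(o, b) ω)).Reachable o y ↔ (openGraph ω).Reachable b y :=
    reachable_insert_one_o_iff hN hbo hy
  rw [e1, e2]

/-- Two virtual pairs at an isolated `o`: `o` is joined exactly to the clusters of `a` and `b`. [folklore] -/
theorem reachable_insert_two_o_iff {ω : BondConfig (Fin n)} {o a b : Fin n} (hN : ∀ v, v ≠ o → s(o, v) ∉ ω)
    (hao : a ≠ o) (hbo : b ≠ o) {y : Fin n} (hy : y ≠ o) :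
    (openGraph (insert s(o, a) (insert s(o, b) ω))).Reachable o y ↔
      (openGraph ω).Reachable a y ∨ (openGraph ω).Reachable b y := by
  rw [KNSep.reachable_insert_iff, reachable_insert_one_o_iff hN hbo hy, reachable_insert_one_iff hN hao hy]
  have e1 : (openGraph (insert s(o, b) ω)).Reachable o o := SimpleGraph.Reachable.refl o
  have e2 : (openGraph (insert s(o, b) ω)).Reachable o a ↔ (openGraph ω).Reachable b a :=
    reachable_insert_one_o_iff hN hbo hao
  rw [e2]
  constructor
  · rintro (h | ⟨-, h⟩ | ⟨h1, h2⟩)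
    · exact Or.inr h
    · exact Or.inl h
    · exact Or.inr h2
  · rintro (h | h)
    · exact Or.inr (Or.inl ⟨e1, h⟩)
    · exact Or.inl h


/-! ### Relay counts after opening the virtual pairs -/

/-- After opening `s(o,a)` at an isolated non-relay `o`, the relays joined to `o` are those joined to `a`. [folklore] -/
theorem filter_insert_one_o (A : Finset (Fin n)) {ω : BondConfig (Fin n)} {o a : Fin n}
    (hN : ∀ v, v ≠ o → s(o, v) ∉ ω) (ho : o ∉ A) (hao : a ≠ o) :
    (A.filter fun r => insert s(o, a) ω ∈ openConn o r) = A.filter fun r => ω ∈ openConn a r := by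
  ext r
  simp only [Finset.mem_filter, and_congr_right_iff]
  intro hr
  have hro : r ≠ o := fun h => ho (h ▸ hr)
  exact reachable_insert_one_o_iff hN hao hro

/-- After opening `s(o,a)` at an isolated non-relay `o`, the relays joined to any `x ≠ o` are unchanged. [folklore] -/
theorem filter_insert_one_ne (A : Finset (Fin n)) {ω : BondConfig (Fin n)} {o a x : Fin n}
    (hN : ∀ v, v ≠ o → s(o, v) ∉ ω) (ho : o ∉ A) (hx : x ≠ o) :
    (A.filter fun r => insert s(o, a) ω ∈ openConn x r) = A.filter fun r => ω ∈ openConn x r := by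
  ext r
  simp only [Finset.mem_filter, and_congr_right_iff]
  intro hr
  have hro : r ≠ o := fun h => ho (h ▸ hr)
  exact reachable_insert_one_iff hN hx hro

/-- After opening both pairs at an isolated non-relay `o`, the relays joined to `o` are those joined to `a` or to `b`. [folklore] -/
theorem filter_insert_two_o (A : Finset (Fin n)) {ω : BondConfig (Fin n)} {o a b : Fin n}
    (hN : ∀ v, v ≠ o → s(o, v) ∉ ω) (ho : o ∉ A) (hao : a ≠ o) (hbo : b ≠ o) :
    (A.filter fun r => insert s(o, a) (insert s(o, b) ω) ∈ openConn o r) =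
      A.filter fun r => ω ∈ openConn a r ∨ ω ∈ openConn b r := by
  ext r
  simp only [Finset.mem_filter, and_congr_right_iff]
  intro hr
  have hro : r ≠ o := fun h => ho (h ▸ hr)
  exact reachable_insert_two_o_iff hN hao hbo hro

/-- After opening both pairs, the relays joined to a vertex `x ≠ o` of the cluster of `a` or of `b` are those joined to `a` or
to `b`. [folklore] -/
theorem filter_insert_two_of_reach (A : Finset (Fin n)) {ω : BondConfig (Fin n)} {o a b x : Fin n}
    (hN : ∀ v, v ≠ o → s(o, v) ∉ ω) (ho : o ∉ A) (hao : a ≠ o) (hbo : b ≠ o) (hx : x ≠ o)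
    (hxab : (openGraph ω).Reachable x a ∨ (openGraph ω).Reachable x b) :
    (A.filter fun r => insert s(o, a) (insert s(o, b) ω) ∈ openConn x r) =
      A.filter fun r => ω ∈ openConn a r ∨ ω ∈ openConn b r := by
  ext r
  simp only [Finset.mem_filter, and_congr_right_iff]
  intro hr
  have hro : r ≠ o := fun h => ho (h ▸ hr)
  change (openGraph (insert s(o, a) (insert s(o, b) ω))).Reachable x r ↔
    (openGraph ω).Reachable a r ∨ (openGraph ω).Reachable b r
  rw [reachable_insert_two_iff hN hao hbo hx hro]
  rcases hxab with hxa | hxb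
  · constructor
    · rintro (h | ⟨-, h⟩ | ⟨-, h⟩)
      · exact Or.inl (hxa.symm.trans h)
      · exact Or.inl h
      · exact Or.inr h
    · rintro (h | h)
      · exact Or.inl (hxa.trans h)
      · exact Or.inr (Or.inr ⟨hxa, h⟩)
  · constructor
    · rintro (h | ⟨-, h⟩ | ⟨-, h⟩)
      · exact Or.inr (hxb.symm.trans h)
      · exact Or.inl h
      · exact Or.inr h
    · rintro (h | h)
      · exact Or.inr (Or.inl ⟨hxb, h⟩)
      · exact Or.inl (hxb.trans h)

/-- After opening both pairs, the relays joined to a vertex `x ≠ o` outside the clusters of `a` and `b` are unchanged. [folklore] -/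
theorem filter_insert_two_of_not_reach (A : Finset (Fin n)) {ω : BondConfig (Fin n)} {o a b x : Fin n}
    (hN : ∀ v, v ≠ o → s(o, v) ∉ ω) (ho : o ∉ A) (hao : a ≠ o) (hbo : b ≠ o) (hx : x ≠ o)
    (hxa : ¬ (openGraph ω).Reachable x a) (hxb : ¬ (openGraph ω).Reachable x b) :
    (A.filter fun r => insert s(o, a) (insert s(o, b) ω) ∈ openConn x r) = A.filter fun r => ω ∈ openConn x r := by
  ext r
  simp only [Finset.mem_filter, and_congr_right_iff]
  intro hr
  have hro : r ≠ o := fun h => ho (h ▸ hr)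
  change (openGraph (insert s(o, a) (insert s(o, b) ω))).Reachable x r ↔ (openGraph ω).Reachable x r
  rw [reachable_insert_two_iff hN hao hbo hx hro]
  constructor
  · rintro (h | ⟨h, -⟩ | ⟨h, -⟩)
    · exact h
    · exact absurd h hxb
    · exact absurd h hxa
  · exact fun h => Or.inl h

/-! ### The measure with the pairs at `o` switched off -/

/-- Under `w₀` (every pair at `o` has weight `0`), almost surely no pair at `o` is open: for every event `E`,
`μ₀(E) = μ₀(E ∩ {no open pair at o})`. [folklore] -/
theorem real_eq_real_inter_isolated (w₀ : Sym2 (Fin n) → unitInterval) (o : Fin n)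
    (hw₀ : ∀ v, v ≠ o → w₀ s(o, v) = 0) (E : Set (BondConfig (Fin n))) :
    (prodBernoulli w₀).real E = (prodBernoulli w₀).real (E ∩ {ω | ∀ v, v ≠ o → s(o, v) ∉ ω}) := by
  set μ := prodBernoulli w₀ with hμ
  set N : Set (BondConfig (Fin n)) := {ω | ∀ v, v ≠ o → s(o, v) ∉ ω} with hN
  have hmeas : ∀ s : Set (BondConfig (Fin n)), MeasurableSet s := fun _ => MeasurableSet.of_discrete
  have hNc : μ.real Nᶜ = 0 := by
    have hsub : Nᶜ ⊆ ⋃ v ∈ (Finset.univ.filter fun v : Fin n => v ≠ o), {ω : BondConfig (Fin n) | s(o, v) ∈ ω} := by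
      intro ω hω
      simp only [hN, mem_compl_iff, mem_setOf_eq, not_forall, not_not, exists_prop] at hω
      obtain ⟨v, hv, hmem⟩ := hω
      exact mem_biUnion (Finset.mem_filter.2 ⟨Finset.mem_univ v, hv⟩) hmem
    refine le_antisymm (le_trans (measureReal_mono hsub (measure_ne_top μ _))
      (le_trans (measureReal_biUnion_finset_le _ _) ?_)) measureReal_nonneg
    refine le_of_eq (Finset.sum_eq_zero fun v hv => ?_)
    rw [hμ, prodBernoulli_real_setOf_mem, hw₀ v (Finset.mem_filter.1 hv).2]
    rfl
  have split := (measureReal_inter_add_sdiff (μ := μ) (s := E) (t := N) (hmeas _)).symm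
  have hz : μ.real (E \ N) = 0 :=
    le_antisymm (le_trans (measureReal_mono (fun ω hω => hω.2) (measure_ne_top μ _)) hNc.le) measureReal_nonneg
  rw [split, hz, add_zero]

/-- **Two-pair decomposition.**  With `w₀ = w[s(o,a) ↦ 0][s(o,b) ↦ 0]`, `α = w(s(o,a))`, `β = w(s(o,b))`, for every event `S`:
`μ_w(S) = (1−α)(1−β) μ₀(S) + (1−α)β μ₀({ω | ω ∪ {ob} ∈ S}) + α(1−β) μ₀({ω | ω ∪ {oa} ∈ S}) + αβ μ₀({ω | ω ∪ {oa,ob} ∈ S})`.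
[folklore] -/
theorem real_twoPair_decomp (w : Sym2 (Fin n) → unitInterval) (o a b : Fin n) (hab : s(o, a) ≠ s(o, b))
    (S : Set (BondConfig (Fin n))) :
    (prodBernoulli w).real S =
      (1 - (w s(o, a) : ℝ)) * (1 - (w s(o, b) : ℝ)) *
          (prodBernoulli (Function.update (Function.update w s(o, a) 0) s(o, b) 0)).real S +
        (1 - (w s(o, a) : ℝ)) * (w s(o, b) : ℝ) *
          (prodBernoulli (Function.update (Function.update w s(o, a) 0) s(o, b) 0)).real
            ((fun ω : BondConfig (Fin n) => insert s(o, b) ω) ⁻¹' S) +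
        (w s(o, a) : ℝ) * (1 - (w s(o, b) : ℝ)) *
          (prodBernoulli (Function.update (Function.update w s(o, a) 0) s(o, b) 0)).real
            ((fun ω : BondConfig (Fin n) => insert s(o, a) ω) ⁻¹' S) +
        (w s(o, a) : ℝ) * (w s(o, b) : ℝ) *
          (prodBernoulli (Function.update (Function.update w s(o, a) 0) s(o, b) 0)).real
            ((fun ω : BondConfig (Fin n) => insert s(o, a) (insert s(o, b) ω)) ⁻¹' S) := by
  set ea := s(o, a) with hea
  set eb := s(o, b) with heb
  set w₁ := Function.update w ea 0 with hw₁
  set w₀ := Function.update w₁ eb 0 with hw₀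
  -- first pair
  have d1 := stub_oneBondDecomp_k15 n w ea S
  rw [tieLiftOne_real_one_eq w ea S] at d1
  -- second pair, for the two events
  have hβ : (w₁ eb : ℝ) = w eb := by
    rw [hw₁, Function.update_of_ne (Ne.symm hab)]
  have d2 : ∀ T : Set (BondConfig (Fin n)), (prodBernoulli w₁).real T =
      (1 - (w eb : ℝ)) * (prodBernoulli w₀).real T +
        (w eb : ℝ) * (prodBernoulli w₀).real ((fun ω : BondConfig (Fin n) => insert eb ω) ⁻¹' T) := by
    intro T
    have d := stub_oneBondDecomp_k15 n w₁ eb T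
    rw [tieLiftOne_real_one_eq w₁ eb T, hβ] at d
    exact d
  rw [d1, d2 S, d2 ((fun ω : BondConfig (Fin n) => insert ea ω) ⁻¹' S)]
  have e : (fun ω : BondConfig (Fin n) => insert eb ω) ⁻¹' ((fun ω : BondConfig (Fin n) => insert ea ω) ⁻¹' S) =
      (fun ω : BondConfig (Fin n) => insert ea (insert eb ω)) ⁻¹' S := rfl
  rw [e]
  ring


/-! ### The algebra of the two-port exchange -/

/-- The real-number core of the two-port exchange: from `(1−t)p + tg ≤ (1−t)P + tG`, `(1−t)r + tg ≤ (1−t)R + tG` (championship),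
`gP ≤ Gp` (glued-pair bound) and `t = αβ`, conclude `α(1−β)p + (1−α)βr + tg ≤ α(1−β)P + (1−α)βR + tG`. [this work] -/
theorem twoPort_algebra {α β p P r R g G : ℝ} (hα0 : 0 ≤ α) (hα1 : α ≤ 1) (hβ0 : 0 ≤ β) (hβ1 : β ≤ 1)
    (hp : 0 ≤ p) (hG : 0 ≤ G)
    (hA : (1 - α * β) * p + α * β * g ≤ (1 - α * β) * P + α * β * G)
    (hB : (1 - α * β) * r + α * β * g ≤ (1 - α * β) * R + α * β * G)
    (gA : g * P ≤ G * p) :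
    α * (1 - β) * p + (1 - α) * β * r + α * β * g ≤ α * (1 - β) * P + (1 - α) * β * R + α * β * G := by
  set t := α * β with ht
  have ht0 : 0 ≤ t := mul_nonneg hα0 hβ0
  have ht1 : t ≤ 1 := by rw [ht]; nlinarith
  -- Step 1: `t (G - g) ≥ 0`
  have hD : 0 ≤ t * (G - g) := by
    by_contra hneg'
    have hneg : t * (G - g) < 0 := lt_of_not_ge hneg'
    have htpos : 0 < t := by
      rcases ht0.eq_or_lt with h | h
      · rw [← h, zero_mul] at hneg; exact absurd hneg (lt_irrefl 0)
      · exact h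
    have hgG : G < g := by nlinarith
    have h1 : (1 - t) * (p - P) < 0 := by nlinarith
    have h1t : 0 < 1 - t := by
      rcases (sub_nonneg.2 ht1).eq_or_lt with h | h
      · rw [← h, zero_mul] at h1; exact absurd h1 (lt_irrefl 0)
      · exact h
    have hpP : p < P := by nlinarith
    have hPpos : 0 < P := lt_of_le_of_lt hp hpP
    -- `gP > GP ≥ Gp`
    have : G * p ≤ G * P := mul_le_mul_of_nonneg_left hpP.le hG
    nlinarith
  -- Step 2
  have hA' : (1 - t) * (p - P) ≤ t * (G - g) := by nlinarith
  have hB' : (1 - t) * (r - R) ≤ t * (G - g) := by nlinarith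
  have hcoef : α * (1 - β) + (1 - α) * β ≤ 1 - t := by rw [ht]; nlinarith [mul_nonneg (sub_nonneg.2 hα1) (sub_nonneg.2 hβ1)]
  have hc1 : 0 ≤ α * (1 - β) := mul_nonneg hα0 (sub_nonneg.2 hβ1)
  have hc2 : 0 ≤ (1 - α) * β := mul_nonneg (sub_nonneg.2 hα1) hβ0
  rcases (sub_nonneg.2 ht1).eq_or_lt with h0 | hpos
  · -- `t = 1`: then `α = β = 1`
    have ht1' : t = 1 := by linarith
    have hα : α = 1 := by
      by_contra hne
      have : α < 1 := lt_of_le_of_ne hα1 hne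
      have : α * β < 1 := by nlinarith
      rw [ht] at ht1'; linarith
    have hβ : β = 1 := by
      rw [ht, hα, one_mul] at ht1'; exact ht1'
    subst hα; subst hβ
    nlinarith
  · -- `t < 1`
    have key : (1 - t) * (α * (1 - β) * (p - P) + (1 - α) * β * (r - R)) ≤ (1 - t) * (t * (G - g)) := by
      have e1 : (1 - t) * (α * (1 - β) * (p - P) + (1 - α) * β * (r - R)) =
          α * (1 - β) * ((1 - t) * (p - P)) + (1 - α) * β * ((1 - t) * (r - R)) := by ring
      rw [e1]
      calc α * (1 - β) * ((1 - t) * (p - P)) + (1 - α) * β * ((1 - t) * (r - R))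
          ≤ α * (1 - β) * (t * (G - g)) + (1 - α) * β * (t * (G - g)) :=
            add_le_add (mul_le_mul_of_nonneg_left hA' hc1) (mul_le_mul_of_nonneg_left hB' hc2)
        _ = (α * (1 - β) + (1 - α) * β) * (t * (G - g)) := by ring
        _ ≤ (1 - t) * (t * (G - g)) := mul_le_mul_of_nonneg_right hcoef hD
    have key' : α * (1 - β) * (p - P) + (1 - α) * β * (r - R) ≤ t * (G - g) := le_of_mul_le_mul_left key hpos
    nlinarith


end TwoPortExchange

end Summit.CriticalPhenomena.PercolationContinuityZ3.Theorems

end
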